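import Summits.QuantumFields.YangMills.Theses.FemtoCutoffLadder

/-!
# FemtoCutoffLadder — the two extreme wall sets of `LocalWallStep` (LINE g5-A stubs)

`SingleWallStep` (stmt-QuantumFields-26631, the step at `Q = ∅`: one κ-wall on the bare femto
transfer matrix) and `LastWallStep` (stmt-QuantumFields-26638, the step at `Q = univ ∖ {p₀}`: the last
wall before B′'s fully compressed pair) are literal specialisations of the crux `LocalWallStep`
(stmt-QuantumFields-26282).  This file records the two specialisation implications, so that a proof
of the crux closes both stubs and a refutation of either stub refutes the crux.

No summit is proved here.
-/

set_option autoImplicit false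

namespace Summit.QuantumFields.YangMills.Theorems.FemtoCutoffLadder

open Summit.QuantumFields.YangMills.Theses.FemtoCutoffLadder

/-- The first stub of LINE g5-A is the crux at the empty wall set. -/
theorem singleWallStep_of_localWallStep (h : LocalWallStep) : SingleWallStep := by
  intro κ hκ hκ1
  obtain ⟨A, lam0, L0, hA, hl0, H⟩ := h κ hκ hκ1
  exact ⟨A, lam0, L0, hA, hl0, fun lam hlam hle L _ hL β hW p₀ =>
    H lam hlam hle L hL β hW ∅ p₀ (Set.notMem_empty _)⟩

/-- The hard-wall stub of LINE g5-A is the crux at the co-singleton wall set. -/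
theorem lastWallStep_of_localWallStep (h : LocalWallStep) : LastWallStep := by
  intro κ hκ hκ1
  obtain ⟨A, lam0, L0, hA, hl0, H⟩ := h κ hκ hκ1
  exact ⟨A, lam0, L0, hA, hl0, fun lam hlam hle L _ hL β hW p₀ =>
    H lam hlam hle L hL β hW (Set.univ \ {p₀}) p₀ (by simp)⟩

/-- Contrapositive bookkeeping: refuting the first stub refutes the crux. -/
theorem not_localWallStep_of_not_singleWallStep (h : ¬ SingleWallStep) : ¬ LocalWallStep :=
  fun h' => h (singleWallStep_of_localWallStep h')

end Summit.QuantumFields.YangMills.Theorems.FemtoCutoffLadder
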